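import Mathlib.MeasureTheory.Function.Jacobian
import Mathlib.Analysis.Calculus.FDeriv.Measurable
import Mathlib.MeasureTheory.Measure.Haar.Unique
import Mathlib.MeasureTheory.Measure.Haar.NormedSpace
import Mathlib.MeasureTheory.Constructions.Pi
import Mathlib.LinearAlgebra.LinearIndependent.Lemmas
import Mathlib.Topology.Algebra.Module.FiniteDimension
import HarnessLib

/-!
# On the preimage of a null set the differential is almost nowhere surjective

Topic `Literature/Analysis/Calculus` (support file for the proof of Federer's support theorem
for integral flat chains, `Literature.Geometry.GeometricMeasureTheory`). Everything here is proved
from Mathlib; no named facts, no definitions.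

**Theorem** (`ae_not_surjective_fderiv_of_mapsTo_null`). Let `h : ℝ^ι → F` be a continuous
map into a finite-dimensional real normed space `F` with an additive Haar measure `ν`, and let
`B ⊆ F` be `ν`-null. Then for Lebesgue-almost every `u` with `h u ∈ B` at which `h` is
differentiable, the differential `Dh(u)` is **not** surjective.

This is the "easy half" of the area and co-area formulae (Federer, *Geometric Measure Theory*,
3.2.3, 3.2.11, 3.2.22: `∫_{h⁻¹ B} J_k h dℒ = ∫_B 𝓗(h⁻¹{y} ∩ ·) dℒᵏ y = 0`, so the `k`-Jacobian
`J_k h = ‖∧ᵏ Dh‖` vanishes a.e. on `h⁻¹ B`), in the purely qualitative form we need and with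
pointwise differentiability only (so that it applies to Lipschitz maps through Rademacher's
theorem).

## The proof

* Equal dimensions, maps `E → E` (`addHaar_null_of_image_null_of_det_ne_zero`): if `f` has within
  `s` a derivative of non-zero determinant at every point of `s` and `f '' s` is null then `s` is
  null — partition `s` into pieces on which `f` is well approximated by invertible linear maps
  (Mathlib's `exists_partition_approximatesLinearOn_of_hasFDerivWithinAt`) and use the lower
  volume bound `m · μ t ≤ μ (f '' t)` on each piece (Mathlib's `mul_le_addHaar_image_of_lt_det`).
* Coordinate selection (`exists_bijective_comp_extendByZero`): a surjective linear map
  `A : ℝ^ι → F` is bijective on the coordinate subspace `ℝ^s` of a suitable `s ⊆ ι` (a maximal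
  linearly independent subfamily of the images of the coordinate vectors).
* Fubini (`ae_not_surjective_fderiv_of_mapsTo_null`): for fixed `s`, split `ℝ^ι = ℝ^s × ℝ^{sᶜ}`
  (`MeasurableEquiv.piEquivPiSubtypeProd`, measure preserving); on each slice `w + ℝ^s` the map
  `v ↦ h(v, w)` followed by a linear isomorphism `F ≃ ℝ^s` is a self-map of `ℝ^s` with invertible
  derivative at the bad points and null image, so the slice of the bad set is null by the first
  step; the bad set is measurable (the differentiability set and `fderiv` of any map are Borel,
  Mathlib's `measurableSet_of_differentiableAt`, `measurable_fderiv`).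

## References

* H. Federer, *Geometric Measure Theory*, Springer 1969, 3.2.3, 3.2.11, 3.2.22.
* L. C. Evans, R. F. Gariepy, *Measure Theory and Fine Properties of Functions*, CRC 1992, §3.4.
-/

noncomputable section

open MeasureTheory MeasureTheory.Measure Set Function Filter
open scoped ENNReal NNReal Topology

namespace Literature.Analysis.Calculus

/-! ### Equal dimensions: null image and invertible derivative force a null set -/

section SameSpace

variable {E : Type*} [NormedAddCommGroup E] [NormedSpace ℝ E] [FiniteDimensional ℝ E]
  [MeasurableSpace E] [BorelSpace E] (μ : Measure E) [IsAddHaarMeasure μ]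

/-- **Null image with invertible derivative forces a null set.** If `f : E → E` has, at every
point of `s` and relative to `s`, a derivative `f' x` with `det (f' x) ≠ 0`, and `μ (f '' s) = 0`
for an additive Haar measure `μ`, then `μ s = 0` (the qualitative content of the change of
variables inequality `∫_s |det f'| dμ ≤ ∫ N(f|s, y) dμ y`). [cite: Federer1969, 3.2.3] -/
theorem addHaar_null_of_image_null_of_det_ne_zero {f : E → E} {s : Set E}
    {f' : E → E →L[ℝ] E} (hf' : ∀ x ∈ s, HasFDerivWithinAt f (f' x) s x)
    (hdet : ∀ x ∈ s, (f' x).det ≠ 0) (h0 : μ (f '' s) = 0) : μ s = 0 := by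
  classical
  rcases s.eq_empty_or_nonempty with rfl | hs
  · simp
  -- for every invertible `A`, a radius `δ A` below which `A`-approximable maps expand `μ` by `m A`
  have key : ∀ A : E →L[ℝ] E, A.det ≠ 0 → ∃ δ : ℝ≥0, 0 < δ ∧ ∀ (t : Set E) (g : E → E),
      ApproximatesLinearOn g A t δ →
        (((|A.det| / 2).toNNReal : ℝ≥0) : ℝ≥0∞) * μ t ≤ μ (g '' t) := by
    intro A hA
    have hpos : 0 < |A.det| := abs_pos.2 hA
    have hm : (((|A.det| / 2).toNNReal : ℝ≥0) : ℝ≥0∞) < ENNReal.ofReal |A.det| := by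
      change ENNReal.ofReal (|A.det| / 2) < ENNReal.ofReal |A.det|
      exact (ENNReal.ofReal_lt_ofReal_iff hpos).2 (by linarith)
    obtain ⟨δ, hδ, hδpos⟩ :=
      ((mul_le_addHaar_image_of_lt_det μ A hm).and self_mem_nhdsWithin).exists
    exact ⟨δ, hδpos, hδ⟩
  choose! δ hδpos hδ using key
  obtain ⟨t, A, -, -, hst, happ, hA⟩ :=
    exists_partition_approximatesLinearOn_of_hasFDerivWithinAt f s f' hf'
      (fun A => if A.det ≠ 0 then δ A else 1)
      (fun A => by
        split_ifs with h
        · exact (hδpos A h).ne'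
        · exact one_ne_zero)
  have hn : ∀ n, μ (s ∩ t n) = 0 := by
    intro n
    obtain ⟨y, hy, hAy⟩ := hA hs n
    have hdet' : (A n).det ≠ 0 := hAy ▸ hdet y hy
    have h1 := happ n
    rw [if_pos hdet'] at h1
    have h2 := hδ (A n) hdet' (s ∩ t n) f h1
    have h3 : μ (f '' (s ∩ t n)) = 0 := measure_mono_null (image_mono inter_subset_left) h0
    rw [h3, nonpos_iff_eq_zero, mul_eq_zero] at h2
    refine h2.resolve_left ?_
    have : 0 < |(A n).det| / 2 := by positivity
    simpa using this
  refine measure_mono_null (fun x hx => ?_) (measure_iUnion_null hn)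
  obtain ⟨n, hxn⟩ := mem_iUnion.1 (hst hx)
  exact mem_iUnion.2 ⟨n, hx, hxn⟩

end SameSpace

/-! ### Coordinate selection for surjective linear maps on `ℝ^ι` -/

section Selection

variable {ι : Type*} [Fintype ι] {F : Type*} [AddCommGroup F] [Module ℝ F]

omit [Fintype ι] in
/-- The zero-extension `ℝ^s → ℝ^ι` sends the coordinate vector `e_j` of `ℝ^s` to the coordinate
vector `e_j` of `ℝ^ι`. [folklore] -/
theorem extendByZero_single [DecidableEq ι] (s : Set ι) (j : s) (c : ℝ) :
    Function.ExtendByZero.linearMap ℝ (Subtype.val : s → ι) (Pi.single j c) = Pi.single (j : ι) c := by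
  ext i
  simp only [Function.ExtendByZero.linearMap_apply]
  by_cases hi : i ∈ s
  · rw [Subtype.val_injective.extend_apply _ _ ⟨i, hi⟩]
    by_cases hij : (⟨i, hi⟩ : s) = j
    · subst hij
      simp
    · have hij' : i ≠ (j : ι) := fun h => hij (Subtype.ext h)
      simp [Pi.single_eq_of_ne hij, Pi.single_eq_of_ne hij']
  · rw [Function.extend_apply' _ _ _ (fun ⟨a, ha⟩ => hi (ha ▸ a.2))]
    have hij' : i ≠ (j : ι) := fun h => hi (h ▸ j.2)
    simp [Pi.single_eq_of_ne hij']

/-- **Coordinate selection.** A surjective linear map `A : ℝ^ι → F` restricts to a bijection on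
the coordinate subspace `ℝ^s ⊆ ℝ^ι` spanned by `{e_i : i ∈ s}` for some `s ⊆ ι` (take a maximal
linearly independent subfamily of `(A e_i)_i`; it spans `F`). Here `ℝ^s → ℝ^ι` is the
zero-extension `Function.ExtendByZero.linearMap`. [folklore] -/
theorem exists_bijective_comp_extendByZero (A : (ι → ℝ) →ₗ[ℝ] F) (hA : Surjective A) :
    ∃ s : Set ι, Bijective (A ∘ₗ Function.ExtendByZero.linearMap ℝ (Subtype.val : s → ι)) := by
  classical
  set w : ι → F := fun i => A (Pi.single i 1) with hw
  obtain ⟨s, hli, hmax⟩ := exists_maximal_linearIndepOn ℝ w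
  refine ⟨s, ?_, ?_⟩
  · -- injectivity from the linear independence of `(w i)_{i ∈ s}`
    set M := A ∘ₗ Function.ExtendByZero.linearMap ℝ (Subtype.val : s → ι) with hM
    have hMs : ∀ j : s, M (Pi.single j 1) = w j := fun j => by
      simp only [hM, LinearMap.coe_comp, Function.comp_apply, extendByZero_single, hw]
    refine (injective_iff_map_eq_zero M).2 fun c hc => ?_
    have hc' : ∑ j : s, c j • w j = 0 := by
      have : c = ∑ j : s, c j • Pi.single j (1 : ℝ) := by
        ext i
        simp [Finset.sum_apply, Pi.single_apply]
      rw [this, _root_.map_sum] at hc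
      simpa only [map_smul, hMs] using hc
    have hli' : LinearIndependent ℝ (fun j : s => w j) := hli
    ext j
    exact Fintype.linearIndependent_iff.1 hli' c hc' j
  · -- surjectivity: the `w i`, `i ∈ s`, span `F`
    set M := A ∘ₗ Function.ExtendByZero.linearMap ℝ (Subtype.val : s → ι) with hM
    have hMs : ∀ j : s, M (Pi.single j 1) = w j := fun j => by
      simp only [hM, LinearMap.coe_comp, Function.comp_apply, extendByZero_single, hw]
    have hspan : ∀ i, w i ∈ Submodule.span ℝ (w '' s) := by
      intro i
      by_cases hi : i ∈ s
      · exact Submodule.subset_span (mem_image_of_mem w hi)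
      · obtain ⟨a, ha, hai⟩ := hmax i hi
        exact (Submodule.smul_mem_iff _ ha).1 hai
    have hrange : Submodule.span ℝ (w '' s) ≤ LinearMap.range M := by
      rw [Submodule.span_le]
      rintro _ ⟨i, hi, rfl⟩
      exact ⟨Pi.single ⟨i, hi⟩ 1, hMs ⟨i, hi⟩⟩
    intro y
    obtain ⟨x, rfl⟩ := hA y
    have hx : A x ∈ Submodule.span ℝ (w '' s) := by
      have : x = ∑ i, x i • Pi.single i (1 : ℝ) := by
        ext i
        simp [Finset.sum_apply, Pi.single_apply]
      rw [this, _root_.map_sum]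
      exact Submodule.sum_mem _ fun i _ => by
        rw [map_smul]
        exact Submodule.smul_mem _ _ (hspan i)
    exact hrange hx

end Selection

/-! ### The main theorem -/

section Main

variable {ι : Type*} [Fintype ι] {F : Type*} [NormedAddCommGroup F] [NormedSpace ℝ F]
  [FiniteDimensional ℝ F] [MeasurableSpace F] [BorelSpace F]

/-- **On the preimage of a null set the differential is a.e. not surjective.** For a continuous
map `h : ℝ^ι → F` into a finite-dimensional space with additive Haar measure `ν` and a `ν`-null
set `B`: for Lebesgue-a.e. `u` with `h u ∈ B` at which `h` is differentiable, `Dh(u)` is not onto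
(the `k`-dimensional Jacobian of `h` vanishes almost everywhere on `h⁻¹ B`, `k = dim F`).
[cite: Federer1969, 3.2.22 (with 3.2.3, 3.2.11)] -/
theorem ae_not_surjective_fderiv_of_mapsTo_null (ν : Measure F) [IsAddHaarMeasure ν]
    {h : (ι → ℝ) → F} (hh : Continuous h) {B : Set F} (hB : ν B = 0) :
    ∀ᵐ u ∂(volume : Measure (ι → ℝ)),
      h u ∈ B → DifferentiableAt ℝ h u → ¬ Surjective (fderiv ℝ h u) := by
  classical
  -- WLOG `B` is measurable
  obtain ⟨B', hBB', hB'm, hB'0⟩ := exists_measurable_superset_of_null hB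
  suffices H : ∀ᵐ u ∂(volume : Measure (ι → ℝ)),
      h u ∈ B' → DifferentiableAt ℝ h u → ¬ Surjective (fderiv ℝ h u) by
    filter_upwards [H] with u hu huB using hu (hBB' huB)
  -- the bad set attached to a set of coordinates `s`
  let ext : ∀ s : Set ι, (s → ℝ) →ₗ[ℝ] (ι → ℝ) := fun s =>
    Function.ExtendByZero.linearMap ℝ (Subtype.val : s → ι)
  let S : Set ι → Set (ι → ℝ) := fun s =>
    {u | h u ∈ B' ∧ DifferentiableAt ℝ h u ∧
      Bijective ((fderiv ℝ h u : (ι → ℝ) →ₗ[ℝ] F) ∘ₗ ext s)}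
  -- it suffices that every `S s` is null
  suffices hS : ∀ s, volume (S s) = 0 by
    have hU : volume (⋃ s, S s) = 0 := measure_iUnion_null hS
    rw [ae_iff]
    refine measure_mono_null (fun u hu => ?_) hU
    simp only [mem_setOf_eq, Classical.not_imp, not_not] at hu
    obtain ⟨huB, hud, hsurj⟩ := hu
    obtain ⟨s, hs⟩ := exists_bijective_comp_extendByZero
      (fderiv ℝ h u : (ι → ℝ) →ₗ[ℝ] F) hsurj
    exact mem_iUnion.2 ⟨s, huB, hud, hs⟩
  intro s
  rcases (S s).eq_empty_or_nonempty with h0 | ⟨u₀, -, -, hu₀⟩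
  · rw [h0, measure_empty]
  -- a linear isomorphism `Ψ : F ≃ ℝ^s` (from the bad point `u₀`)
  let Ψ : F ≃L[ℝ] (s → ℝ) :=
    (LinearEquiv.ofBijective _ hu₀).symm.toContinuousLinearEquiv
  let extL : (s → ℝ) →L[ℝ] (ι → ℝ) := LinearMap.toContinuousLinearMap (ext s)
  have hextL : ∀ v, extL v = ext s v := fun v => rfl
  -- bijectivity of `Dh(u) ∘ ext` is the non-vanishing of a determinant
  have hbij : ∀ L : (ι → ℝ) →L[ℝ] F,
      Bijective ((L : (ι → ℝ) →ₗ[ℝ] F) ∘ₗ ext s) ↔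
        ((Ψ : F →L[ℝ] (s → ℝ)).comp (L.comp extL)).det ≠ 0 := by
    intro L
    have e1 : (((Ψ : F →L[ℝ] (s → ℝ)).comp (L.comp extL) : (s → ℝ) →L[ℝ] (s → ℝ)) :
        (s → ℝ) → (s → ℝ)) = Ψ ∘ ((L : (ι → ℝ) →ₗ[ℝ] F) ∘ₗ ext s) := rfl
    rw [ContinuousLinearMap.det, ← isUnit_iff_ne_zero, ← LinearMap.isUnit_iff_isUnit_det,
      Module.End.isUnit_iff]
    change Bijective _ ↔ Bijective ((((Ψ : F →L[ℝ] (s → ℝ)).comp (L.comp extL) :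
        (s → ℝ) →L[ℝ] (s → ℝ)) : (s → ℝ) → (s → ℝ)))
    rw [e1]
    exact ⟨fun hb => Ψ.bijective.comp hb,
      fun hb => (Bijective.of_comp_iff' Ψ.bijective _).1 hb⟩
  -- hence `S s` is measurable
  have hSm : MeasurableSet (S s) := by
    have e2 : S s = h ⁻¹' B' ∩ {u | DifferentiableAt ℝ h u} ∩
        {u | ((Ψ : F →L[ℝ] (s → ℝ)).comp ((fderiv ℝ h u).comp extL)).det ≠ 0} := by
      ext u
      simp only [S, mem_setOf_eq, mem_inter_iff, mem_preimage, hbij]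
      tauto
    rw [e2]
    refine ((hh.measurable hB'm).inter (measurableSet_of_differentiableAt ℝ h)).inter ?_
    have hc : Continuous fun L : (ι → ℝ) →L[ℝ] F =>
        ((Ψ : F →L[ℝ] (s → ℝ)).comp (L.comp extL)).det :=
      ContinuousLinearMap.continuous_det.comp
        (continuous_const.clm_comp (continuous_id.clm_comp continuous_const))
    exact (hc.measurable.comp (measurable_fderiv ℝ h)) (isClosed_singleton.isOpen_compl.measurableSet)
  -- split the coordinates: `ℝ^ι ≃ ℝ^s × ℝ^{sᶜ}`, measure preserving
  let e := MeasurableEquiv.piEquivPiSubtypeProd (fun _ : ι => ℝ) (· ∈ s)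
  have he : MeasurePreserving e volume (volume.prod volume) :=
    volume_preserving_piEquivPiSubtypeProd (fun _ : ι => ℝ) (· ∈ s)
  -- the inverse splitting is `(v, w) ↦ ext v + (0, w)`
  have hsymm : ∀ (v : s → ℝ) (w : {i // i ∉ s} → ℝ),
      e.symm (v, w) = extL v + e.symm (0, w) := by
    intro v w
    ext i
    simp only [e, MeasurableEquiv.piEquivPiSubtypeProd_symm_apply, Pi.add_apply, hextL,
      Function.ExtendByZero.linearMap_apply, ext]
    by_cases hi : i ∈ s
    · rw [Subtype.val_injective.extend_apply _ _ ⟨i, hi⟩]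
      simp [hi]
    · rw [Function.extend_apply' _ _ _ (fun ⟨a, ha⟩ => hi (ha ▸ a.2))]
      simp [hi]
  -- every slice `{v | e.symm (v, w) ∈ S s}` is null, by the equal-dimensional case
  have hslice : ∀ w : {i // i ∉ s} → ℝ,
      volume {v : s → ℝ | e.symm (v, w) ∈ S s} = 0 := by
    intro w
    set T := {v : s → ℝ | e.symm (v, w) ∈ S s} with hT
    let g : (s → ℝ) → (s → ℝ) := fun v => Ψ (h (e.symm (v, w)))
    let g' : (s → ℝ) → (s → ℝ) →L[ℝ] (s → ℝ) := fun v =>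
      (Ψ : F →L[ℝ] (s → ℝ)).comp ((fderiv ℝ h (e.symm (v, w))).comp extL)
    have hg' : ∀ v ∈ T, HasFDerivWithinAt g (g' v) T v := by
      intro v hv
      have hv' : e.symm (v, w) ∈ S s := hv
      have hL : HasFDerivAt (fun v : s → ℝ => e.symm (v, w)) extL v := by
        have : (fun v : s → ℝ => e.symm (v, w)) = fun v => extL v + e.symm (0, w) :=
          funext fun v => hsymm v w
        rw [this]
        exact extL.hasFDerivAt.add_const _
      have h1 : HasFDerivAt (fun v : s → ℝ => h (e.symm (v, w)))
          ((fderiv ℝ h (e.symm (v, w))).comp extL) v :=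
        hv'.2.1.hasFDerivAt.comp v hL
      exact ((Ψ : F →L[ℝ] (s → ℝ)).hasFDerivAt.comp v h1).hasFDerivWithinAt
    have hgdet : ∀ v ∈ T, (g' v).det ≠ 0 := fun v hv => (hbij _).1 hv.2.2
    have hgT : volume (g '' T) = 0 := by
      have hsub : g '' T ⊆ Ψ '' B' := by
        rintro _ ⟨v, hv, rfl⟩
        exact ⟨h (e.symm (v, w)), hv.1, rfl⟩
      refine measure_mono_null hsub ?_
      rw [ContinuousLinearEquiv.image_eq_preimage_symm,
        ← Measure.map_apply Ψ.symm.continuous.measurable hB'm]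
      haveI : IsAddHaarMeasure ((volume : Measure (s → ℝ)).map Ψ.symm) :=
        Ψ.symm.isAddHaarMeasure_map _
      exact Measure.absolutelyContinuous_isAddHaarMeasure _ ν hB'0
    exact addHaar_null_of_image_null_of_det_ne_zero volume hg' hgdet hgT
  -- Fubini
  have hmeas : MeasurableSet (e.symm ⁻¹' S s) := e.symm.measurable hSm
  have h1 : volume (S s) = (volume.prod volume) (e.symm ⁻¹' S s) := by
    have : e ⁻¹' (e.symm ⁻¹' S s) = S s := by
      ext u
      simp
    calc volume (S s) = volume (e ⁻¹' (e.symm ⁻¹' S s)) := by rw [this]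
      _ = (volume.prod volume) (e.symm ⁻¹' S s) := he.measure_preimage hmeas.nullMeasurableSet
  rw [h1, Measure.prod_apply_symm hmeas]
  have h2 : ∀ w : {i // i ∉ s} → ℝ,
      volume ((fun v : s → ℝ => (v, w)) ⁻¹' (e.symm ⁻¹' S s)) = 0 := fun w => hslice w
  rw [lintegral_congr h2, lintegral_zero]

end Main

end Literature.Analysis.Calculus
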